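import Mathlib
import Summits.ResolutionOfSingularities.ResolutionOfSingularities.Theses.WildQuotients

/-!
# The rationality law of the tame ghost (route `WildQuotients`, item `GhostRationality`)

Support item stmt-ResolutionOfSingularities-17943 of route `ResolutionOfSingularities/WildQuotients`
(card `tame-ghost-of-a-wild-action-v2`, fact (R)), proved as stated:
let `B` be a local domain of characteristic `p` and `σ` a ring automorphism with `σ ^ p = 1`; let
`x₁,…,x_c` be nonzero elements of the maximal ideal `𝔪` with `σ(x_i) = x_i·(1 + M·u_i)`,
`M = ∏_j x_j^{a_j}`, and suppose `σ(b) − b ∈ M·𝔪` for every `b` (a bad point in monomial phase). Then,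
in the residue field, `ū_i ^ p = ū_i · γ̄ ^ (p-1)` with `γ = ∑_j a_j u_j`.

Proof (the card's hand proof, made exact). Put `D = σ − 1`. (1) `D^p = 0`: in the ring of additive
(`ℤ`-linear) endomorphisms of `B`, which has characteristic `p`, `(σ − 1)^p = σ^p − 1 = 0`.
(2) If `M ∈ 𝔪`: by induction on `j`, `D^j(x_i) = x_i M^j (∏_{l<j}(u_i + lγ) + m_j)` with `m_j ∈ 𝔪`,
using `σ(M) = M(1 + Mθ)` with `θ = γ + M·E` (binomial expansion of `∏(1 + M u_j)^{a_j}`),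
`(1 + Mθ)^j = 1 + jMθ + M²Q` and `σ(b) − b ∈ M𝔪`; at `j = p`, `B` being a domain and `x_i M^p ≠ 0`,
`∏_{l<p}(ū_i + lγ̄) = 0`, so `ū_i = −l·γ̄` for some `l < p`, and `(−l)^p = −l` (Frobenius fixes the
prime field) gives `ū_i^p = ū_i γ̄^{p−1}`. (3) If `M ∉ 𝔪` then every `a_j = 0`, `M = 1`, `γ = 0`,
`σ ≡ id (mod 𝔪)`, and `x_i = σ^p(x_i) = x_i ∏_{l<p} σ^l(1+u_i)` gives `(1 + ū_i)^p = 1`, i.e.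
`ū_i = 0`, which is the claim (`0^{p-1} = 0`).

References: card tame-ghost-of-a-wild-action-v2 (fact (R)); F. Király, W. Lütkebohmert, *Group
actions of prime order on local normal rings*, Algebra & Number Theory 7 (2013), §4 (the
pseudo-derivation `σ − 1`). The critic's remark: (R) is the pointwise shadow of the
Sekiguchi–Oort–Suwa interpolation between `μ_p` and `ℤ/p` (a `λ`-derivation with `D^p = λ^{p-1} D`).
-/

-- single-problem summit: the doubled namespace component `ResolutionOfSingularities` is forced
set_option linter.dupNamespace false

namespace Summit.ResolutionOfSingularities.ResolutionOfSingularities.Theorems.WildQuotients.GhostRationality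

open IsLocalRing Finset

section Algebra

variable {B : Type*} [CommRing B]

/-- Binomial expansion to second order: `(1 + N y)^j = 1 + j·(N y) + N²·Q`. [folklore] -/
theorem exists_one_add_mul_pow (N y : B) (j : ℕ) :
    ∃ Q : B, (1 + N * y) ^ j = 1 + (j : B) * (N * y) + N ^ 2 * Q := by
  induction j with
  | zero => exact ⟨0, by simp⟩
  | succ j ih =>
    obtain ⟨Q, hQ⟩ := ih
    refine ⟨Q * (1 + N * y) + (j : B) * y ^ 2, ?_⟩
    rw [pow_succ, hQ]
    push_cast
    ring

/-- Expansion to second order of a product of powers of principal `N`-units: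
`∏_j (1 + N u_j)^{a_j} = 1 + N·(∑_j a_j u_j) + N²·E`. [folklore] -/
theorem exists_prod_one_add_mul_pow {ι : Type*} [DecidableEq ι] (s : Finset ι) (N : B)
    (u : ι → B) (a : ι → ℕ) :
    ∃ E : B, ∏ j ∈ s, (1 + N * u j) ^ a j =
      1 + N * (∑ j ∈ s, (a j : B) * u j) + N ^ 2 * E := by
  induction s using Finset.induction_on with
  | empty => exact ⟨0, by simp⟩
  | insert i s hi ih =>
    obtain ⟨E, hE⟩ := ih
    obtain ⟨Q, hQ⟩ := exists_one_add_mul_pow N (u i) (a i)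
    refine ⟨Q * (1 + N * (∑ j ∈ s, (a j : B) * u j) + N ^ 2 * E) +
      E * (1 + (a i : B) * (N * u i)) + ((a i : B) * u i) * (∑ j ∈ s, (a j : B) * u j), ?_⟩
    rw [prod_insert hi, sum_insert hi, hQ, hE]
    ring

/-- The ring of additive endomorphisms of a ring of prime characteristic `p` has characteristic
`p`. [folklore] -/
theorem charP_end_int (p : ℕ) [CharP B p] : CharP (Module.End ℤ B) p := by
  refine ⟨fun n => ?_⟩
  rw [← CharP.cast_eq_zero_iff B p n]
  constructor
  · intro h
    have := congrArg (fun f : Module.End ℤ B => f 1) h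
    simpa [Module.End.natCast_apply] using this
  · intro h
    ext b
    rw [Module.End.natCast_apply, LinearMap.zero_apply, nsmul_eq_mul, h, zero_mul]

/-- **`(σ − 1)^p = 0`**: for a ring automorphism `σ` of a ring of prime characteristic `p` with
`σ ^ p = 1`, the `p`-th iterate of `b ↦ σ b − b` vanishes (the binomial coefficients
`binom p k`, `0 < k < p`, vanish in characteristic `p`). [cite: KiralyLutkebohmert2013, §4] -/
theorem iterate_sub_self_eq_zero (p : ℕ) [Fact p.Prime] [CharP B p] (σ : B ≃+* B)
    (hσ : σ ^ p = RingEquiv.refl B) (b : B) :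
    (fun y => σ y - y)^[p] b = 0 := by
  haveI := charP_end_int (B := B) p
  let L : Module.End ℤ B := (σ : B →+* B).toAddMonoidHom.toIntLinearMap
  have hL : ∀ y, L y = σ y := fun y => rfl
  have hcomm : Commute L 1 := Commute.one_right L
  have hpow : ∀ (n : ℕ) (y : B), (L ^ n) y = (σ ^ n) y := by
    intro n
    induction n with
    | zero => intro y; simp
    | succ n ih =>
      intro y
      rw [pow_succ', Module.End.mul_apply, ih, hL, pow_succ', RingAut.mul_apply]
  have hLp : L ^ p = 1 := by
    ext y
    rw [hpow, hσ]
    rfl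
  have hsub : (L - 1) ^ p = 0 := by
    rw [sub_pow_char_of_commute (p := p) hcomm, hLp, one_pow, sub_self]
  have hiter : ∀ (n : ℕ) (y : B), ((L - 1) ^ n) y = (fun y => σ y - y)^[n] y := by
    intro n
    induction n with
    | zero => intro y; simp
    | succ n ih =>
      intro y
      rw [pow_succ', Module.End.mul_apply, ih, Function.iterate_succ_apply', LinearMap.sub_apply,
        Module.End.one_apply, hL]
  rw [← hiter, hsub, LinearMap.zero_apply]

/-- `b ↦ σ b − b` is additive, so its iterates commute with negation-free bookkeeping: the iterate
of a difference operator at `x` is determined by the previous iterate (restatement of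
`Function.iterate_succ_apply'` used below). [folklore] -/
theorem iterate_sub_succ (σ : B ≃+* B) (n : ℕ) (b : B) :
    (fun y => σ y - y)^[n + 1] b = σ ((fun y => σ y - y)^[n] b) - (fun y => σ y - y)^[n] b :=
  Function.iterate_succ_apply' _ n b

end Algebra

/-- **The rationality law of the tame ghost** (item `GhostRationality`,
stmt-ResolutionOfSingularities-17943, as stated in the route file): for a local domain `B` of
characteristic `p`, `σ ^ p = 1`, nonzero `x_i ∈ 𝔪` with `σ(x_i) = x_i(1 + M u_i)`, `M = ∏ x_j^{a_j}`,
and `σ(b) − b ∈ M·𝔪` for all `b`: `ū_i^p = ū_i·γ̄^{p-1}` in the residue field, `γ = ∑ a_j u_j`.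
(Card `tame-ghost-of-a-wild-action-v2`, fact (R).) [cite: KiralyLutkebohmert2013, §4] -/
theorem ghostRationality_proof :
    Summit.ResolutionOfSingularities.ResolutionOfSingularities.Theses.WildQuotients.GhostRationality := by
  intro p hp B _ _ _ _ σ hσp c x u a hx0 hxm hσx hD i
  classical
  haveI : Fact p.Prime := ⟨hp⟩
  set N : B := ∏ j, x j ^ a j with hN
  set γ : B := ∑ j, (a j : B) * u j with hγ
  have hp1 : 1 ≤ p := hp.one_lt.le
  -- Frobenius on the residue field fixes the prime field
  haveI : CharP (ResidueField B) p := CharP.of_ringHom_of_ne_zero (residue B) p hp.ne_zero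
  have frob_nat : ∀ l : ℕ, (-(l : ResidueField B)) ^ p = -(l : ResidueField B) := by
    intro l
    rw [← frobenius_def, map_neg, map_natCast]
  by_cases hNm : N ∈ maximalIdeal B
  · /- Case `M ∈ 𝔪`: the main induction. -/
    obtain ⟨E, hE⟩ := exists_prod_one_add_mul_pow (Finset.univ : Finset (Fin c)) N u a
    set θ : B := γ + N * E with hθ
    have hσN : σ N = N * (1 + N * θ) := by
      have : σ N = N * ∏ j, (1 + N * u j) ^ a j := by
        rw [hN, map_prod]
        simp_rw [map_pow, hσx, mul_pow]
        rw [prod_mul_distrib]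
      rw [this, hE, hθ]
      ring
    -- the invariant
    have key : ∀ j : ℕ, ∃ m ∈ maximalIdeal B,
        (fun y => σ y - y)^[j] (x i) =
          x i * N ^ j * ((∏ l ∈ range j, (u i + (l : B) * γ)) + m) := by
      intro j
      induction j with
      | zero => exact ⟨0, Ideal.zero_mem _, by simp⟩
      | succ j ih =>
        obtain ⟨m, hm, hj⟩ := ih
        set G : B := (∏ l ∈ range j, (u i + (l : B) * γ)) + m with hG
        obtain ⟨r, hr, hrG⟩ := hD G
        obtain ⟨Q, hQ⟩ := exists_one_add_mul_pow N θ j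
        have hσG : σ G = G + N * r := by rw [← hrG]; ring
        -- the error term of level j+1
        set A₁ : B := u i + (j : B) * γ with hA₁
        set A₂ : B := (j : B) * E + Q + (j : B) * u i * θ + u i * N * Q with hA₂
        refine ⟨A₁ * m + r + N * (A₂ * G + A₁ * r) + N ^ 2 * (A₂ * r), ?_, ?_⟩
        · refine Ideal.add_mem _ (Ideal.add_mem _ (Ideal.add_mem _
            (Ideal.mul_mem_left _ _ hm) hr) (Ideal.mul_mem_right _ _ hNm)) ?_
          exact Ideal.mul_mem_right _ _ (Ideal.pow_mem_of_mem _ hNm 2 (by norm_num))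
        · rw [iterate_sub_succ, hj, map_mul, map_mul, map_pow, hσx, hσN, hσG, mul_pow, hQ,
            prod_range_succ]
          rw [hA₁, hA₂, hG, hθ]
          ring
    -- at level p the iterate vanishes
    obtain ⟨m, hm, hpth⟩ := key p
    rw [iterate_sub_self_eq_zero p σ hσp] at hpth
    have hxN : x i * N ^ p ≠ 0 := by
      refine mul_ne_zero (hx0 i) (pow_ne_zero _ ?_)
      rw [hN]
      exact prod_ne_zero_iff.mpr fun j _ => pow_ne_zero _ (hx0 j)
    have hsum : (∏ l ∈ range p, (u i + (l : B) * γ)) + m = 0 :=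
      (mul_eq_zero.mp hpth.symm).resolve_left hxN
    -- pass to the residue field
    have hres : ∏ l ∈ range p, (residue B (u i) + (l : ResidueField B) * residue B γ) = 0 := by
      have h1 : residue B ((∏ l ∈ range p, (u i + (l : B) * γ)) + m) = 0 := by
        rw [hsum, map_zero]
      rw [map_add, (residue_eq_zero_iff m).mpr hm, add_zero, map_prod] at h1
      simpa [map_add, map_mul, map_natCast] using h1
    obtain ⟨l, -, hl⟩ := prod_eq_zero_iff.mp hres
    have hu : residue B (u i) = -(l : ResidueField B) * residue B γ := by
      rw [neg_mul, eq_neg_iff_add_eq_zero, hl]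
    have hγres : residue B γ = residue B (∑ j, (a j : B) * u j) := by rw [hγ]
    rw [← hγres, hu, mul_pow, frob_nat l, mul_assoc, ← pow_succ', Nat.sub_add_cancel hp1]
  · /- Case `M ∉ 𝔪`: all exponents vanish, `M = 1`, `γ = 0`, and `ū_i = 0`. -/
    have ha : ∀ j, a j = 0 := by
      intro j
      by_contra hj
      apply hNm
      rw [hN, ← Finset.mul_prod_erase _ _ (Finset.mem_univ j)]
      refine Ideal.mul_mem_right _ _ ?_
      exact Ideal.pow_mem_of_mem _ (hxm j) _ (Nat.pos_of_ne_zero hj)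
    have hN1 : N = 1 := by
      rw [hN]
      exact prod_eq_one fun j _ => by rw [ha j, pow_zero]
    have hγ0 : residue B (∑ j, (a j : B) * u j) = 0 := by
      rw [Finset.sum_eq_zero fun j _ => by rw [ha j, Nat.cast_zero, zero_mul], map_zero]
    rw [hγ0, zero_pow (Nat.sub_ne_zero_of_lt hp.one_lt), mul_zero]
    -- `σ ≡ id (mod 𝔪)`
    have hσres : ∀ b, residue B (σ b) = residue B b := by
      intro b
      obtain ⟨r, hr, hrb⟩ := hD b
      rw [hN1, one_mul] at hrb
      have : residue B (σ b - b) = 0 := (residue_eq_zero_iff _).mpr (hrb ▸ hr)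
      rwa [map_sub, sub_eq_zero] at this
    -- `σ^k (x i) = x i * ∏_{l<k} σ^l (1 + u i)`
    have hiter : ∀ k : ℕ, (σ ^ k) (x i) = x i * ∏ l ∈ range k, (σ ^ l) (1 + u i) := by
      intro k
      induction k with
      | zero => simp
      | succ k ih =>
        rw [pow_succ', RingAut.mul_apply, ih, map_mul, hσx, hN1, one_mul, map_prod,
          prod_range_succ', pow_zero, RingAut.one_apply]
        simp_rw [← RingAut.mul_apply, ← pow_succ']
        ring
    have hP : ∏ l ∈ range p, (σ ^ l) (1 + u i) = 1 := by
      have h := hiter p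
      rw [hσp] at h
      have h' : x i * (∏ l ∈ range p, (σ ^ l) (1 + u i) - 1) = 0 := by
        rw [mul_sub, mul_one, ← h]; exact sub_self _
      exact sub_eq_zero.mp ((mul_eq_zero.mp h').resolve_left (hx0 i))
    have hresiter : ∀ (k : ℕ) (b : B), residue B ((σ ^ k) b) = residue B b := by
      intro k
      induction k with
      | zero => intro b; simp
      | succ k ih => intro b; rw [pow_succ', RingAut.mul_apply, hσres, ih]
    have h1 : (1 + residue B (u i)) ^ p = 1 := by
      have := congrArg (residue B) hP
      rw [map_prod, map_one] at this
      simp_rw [hresiter, map_add, map_one] at this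
      rwa [prod_const, card_range] at this
    rw [add_pow_char, one_pow, add_eq_left] at h1
    rw [h1]

end Summit.ResolutionOfSingularities.ResolutionOfSingularities.Theorems.WildQuotients.GhostRationality
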